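import Summits.RiemannHypothesis.RiemannHypothesis.Theses.SignCone
import Literature.NumberTheory.LFunctions.WeilExplicit

/-!
# Crux `SignCone.SignConeOscillatory` (stmt-RiemannHypothesis-16302), line `dual_witness`: vocabulary

Route `RiemannHypothesis/SignCone`, crux `SignConeOscillatory` (item stmt-RiemannHypothesis-16302), line
`dual_witness` (planner `planner-inv-stmt-RiemannHypothesis-16302-dual-witness-0`, 2026-08-17, crux workfile
`Cruxes/SignConeOscillatory/Lines/dual_witness.lean`).  The line splits the crux through the EXTREMAL FUNCTION of its
own linear programme: `SignConeExtremalExists` (X₁, RH-free: at every cutoff the sign-cone value is attained by an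
`L²`-autocorrelation carrying a KKT certificate) and `SignConeExtremalNonneg` (X₂, RH-strength: every such
configuration has nonnegative value), with a sorry-free assembly `X₁ → X₂ → SignConeOscillatory` in the workfile.

This file reproduces the line's DEFINITIONS VERBATIM (Theorems files cannot import crux workfiles), so that
`--supports` files of this directory can prove the registered stub `stub_extremalExists : SignConeExtremalExists`
against literally the same terms (the workfile's `SignConeOscillatory_of` then closes by `exact`).  All of them are
over Mathlib primitives (the route's CONE NOTE, rev 3) and unfold DEFINITIONALLY to the Weil vocabulary of
`Literature.NumberTheory.LFunctions.WeilExplicit`; the `rfl` bridges at the end record this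
(`autocorr = weilConv g (weilReflect g)`, `mellinShift = weilMellin`, `reWar F = Re (weilPolarTerm F + weilArchTerm F)`).

Definitions (docstrings copied from the workfile; junk values: `autocorr`, `mellinShift`, `reWar` are plain
Bochner integrals and return `0` on non-integrable input — every statement using them on `L²` data also asserts
the relevant integrability): `autocorr`, `mellinShift`, `archIntegrand`, `reWar`, `fakePrimeSum`, `IsConeFamily`,
`coneSum`, `IsExtremalKKT` (the parameterless `SignConeExtremalExists` / `SignConeExtremalNonneg` are spelled as local notations
in the proof file, see the note below); and the sign-cone value `coneValue a = sInf (valueSet a)`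
over `IsAdmissible a` tests, used by the proof of the stub.
-/

noncomputable section

-- `Summit.RiemannHypothesis.RiemannHypothesis.…` repeats a namespace component by design (D-0017 layout).
set_option linter.dupNamespace false

open scoped BigOperators ComplexConjugate
open MeasureTheory

namespace Summit.RiemannHypothesis.RiemannHypothesis.Theorems.SignCone.DualWitness

/-- The autocorrelation `g ⋆ g̃`, spelled exactly as in the route items (line `dual_witness`, verbatim). [folklore] -/
def autocorr (g : ℝ → ℂ) : ℝ → ℂ :=
  MeasureTheory.convolution g (fun u => (starRingEnd ℂ) (g (-u))) (ContinuousLinearMap.mul ℂ ℂ)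
    MeasureTheory.MeasureSpace.volume

/-- The shifted Mellin–Fourier transform `M_F(s) = ∫ F(u) e^{(s - 1/2)u} du` (the binder `M` of the route items;
line `dual_witness`, verbatim). [folklore] -/
def mellinShift (F : ℝ → ℂ) (s : ℂ) : ℂ := ∫ u : ℝ, F u * Complex.exp ((s - 1 / 2) * u)

/-- The archimedean integrand `M_F(1/2 + it) · Re ψ(1/4 + it/2)` (line `dual_witness`, verbatim). [folklore] -/
def archIntegrand (F : ℝ → ℂ) (t : ℝ) : ℂ :=
  mellinShift F (1 / 2 + t * Complex.I) * ((Complex.digamma (1 / 4 + t / 2 * Complex.I)).re : ℂ)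

/-- `Re W_ar(F)` = real part of the polar-plus-archimedean Weil form, verbatim the right-hand side of the route
items (line `dual_witness`, verbatim). [folklore] -/
def reWar (F : ℝ → ℂ) : ℝ :=
  (mellinShift F 0 + mellinShift F 1 + ((1 / (2 * Real.pi) : ℂ) * (∫ t : ℝ, archIntegrand F t)
    - F 0 * (Real.log Real.pi : ℂ))).re

/-- The truncated fake prime sum `P_c^{(N)}(F) = Σ_{2 ≤ n ≤ N} c(n) n^{-1/2} · 2 Re F(log n)` (line `dual_witness`,
verbatim). [folklore] -/
def fakePrimeSum (c : ℕ → ℝ) (N : ℕ) (F : ℝ → ℂ) : ℝ :=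
  ∑ n ∈ Finset.Icc 2 N, c n / Real.sqrt n * (2 * (F (Real.log n)).re)

/-- The sign-cone families of the crux at cutoff `a`: finitely many smooth compactly supported `gᵢ` in `[-a, a]`
(line `dual_witness`, verbatim). [folklore] -/
def IsConeFamily (a : ℝ) (k : ℕ) (g : Fin k → ℝ → ℂ) : Prop :=
  ∀ i, (ContDiff ℝ ((⊤ : ℕ∞) : WithTop ℕ∞) (g i) ∧ HasCompactSupport (g i)) ∧ tsupport (g i) ⊆ Set.Icc (-a) a

/-- Their autocorrelation sum `F = Σᵢ gᵢ ⋆ g̃ᵢ` (the binder `F` of the route items; line `dual_witness`, verbatim).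
[folklore] -/
def coneSum (k : ℕ) (g : Fin k → ℝ → ℂ) : ℝ → ℂ := fun t => ∑ i, autocorr (g i) t

/-- **KKT-extremal configuration at cutoff `a` with value `μ`** (line `dual_witness`, verbatim):
(i) `μ` is a lower bound for `(Re W_ar(F) + Re F(0)) / Re F(0)` on the node-nonnegative sign cone at cutoff `a`;
(ii) it is ATTAINED by the `L²`-autocorrelation `f ⋆ f̃` (`supp f ⊆ [-a,a]`, `Re (f⋆f̃)(0) = ‖f‖₂² = 1`,
node-nonnegative, archimedean integrand integrable — so `reWar` is the genuine value, no junk integral);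
(iii) the nonnegative node weight `c` (fake von Mangoldt, nodes `2 ≤ n ≤ N`, `e^{2a} ≤ N`) is DUAL-FEASIBLE with slack
parameter `1 - μ` on every smooth test supported in `[-a, a]`;
(iv) complementary slackness: `c` annihilates the node values of `f ⋆ f̃`. [folklore] -/
def IsExtremalKKT (a μ : ℝ) (N : ℕ) (c : ℕ → ℝ) (f : ℝ → ℂ) : Prop :=
  Real.exp (2 * a) ≤ N ∧ (∀ n, 0 ≤ c n) ∧
  (∀ (k : ℕ) (g : Fin k → ℝ → ℂ), IsConeFamily a k g →
      (∀ n : ℕ, 2 ≤ n → 0 ≤ (coneSum k g (Real.log n)).re) →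
      μ * (coneSum k g 0).re ≤ reWar (coneSum k g) + (coneSum k g 0).re) ∧
  (MemLp f 2 volume ∧ Function.support f ⊆ Set.Icc (-a) a ∧ (autocorr f 0).re = 1 ∧
      (∀ n : ℕ, 2 ≤ n → 0 ≤ (autocorr f (Real.log n)).re) ∧
      Integrable (archIntegrand (autocorr f)) volume ∧
      reWar (autocorr f) + 1 = μ) ∧
  (∀ g : ℝ → ℂ, (ContDiff ℝ ((⊤ : ℕ∞) : WithTop ℕ∞) g ∧ HasCompactSupport g) → tsupport g ⊆ Set.Icc (-a) a →
      fakePrimeSum c N (autocorr g) ≤ reWar (autocorr g) + (1 - μ) * (autocorr g 0).re) ∧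
  fakePrimeSum c N (autocorr f) = 0

/-! ### Note on `SignConeExtremalExists` / `SignConeExtremalNonneg`
The workfile's two PARAMETERLESS propositions `SignConeExtremalExists := ∀ a > 0, ∃ μ N c f, IsExtremalKKT a μ N c f` (X₁) and
`SignConeExtremalNonneg := ∀ a μ, 0 < a → ∀ N c f, IsExtremalKKT a μ N c f → 0 ≤ μ` (X₂) are route-internal statements, not
literature facts, and parameterless `def … : Prop` cannot live in a Theorems file (the gate relocates them to `Literature/`);
the proof file `…StubExtremalExists.lean` therefore spells them as LOCAL NOTATIONS for exactly these bodies, so that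
`theorem stub_extremalExists : SignConeExtremalExists` there has literally the workfile's statement (unfolded once) as its type.
-/

/-! ## The sign-cone value (used by the proof of `stub_extremalExists`) -/

open Literature.NumberTheory.LFunctions in
/-- Admissible normalised node-nonnegative single tests at cutoff `a`: Weil tests `g` with `tsupport g ⊆ [-a, a]`,
`∫ |g|² = 1` and `g ⋆ g̃` node-nonnegative. [folklore] -/
def IsAdmissible (a : ℝ) (g : ℝ → ℂ) : Prop :=
  IsWeilTest g ∧ tsupport g ⊆ Set.Icc (-a) a ∧ ∫ t, ‖g t‖ ^ 2 = 1 ∧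
    ∀ n : ℕ, 2 ≤ n → 0 ≤ (autocorr g (Real.log n)).re

/-- The value set `{reWar (g ⋆ g̃) + 1 : g admissible at cutoff a}`. [folklore] -/
def valueSet (a : ℝ) : Set ℝ := {x | ∃ g : ℝ → ℂ, IsAdmissible a g ∧ x = reWar (autocorr g) + 1}

/-- The SIGN-CONE VALUE at cutoff `a`: `m(a) = inf valueSet a`, the infimum of `(Re W_ar(F) + Re F(0)) / Re F(0)` over
the node-nonnegative sign cone (by the Boas–Kac reduction to single tests; junk `sInf ∅`-style values never occur:
the set is nonempty and bounded below, `…StubExtremalExistsValue.lean`). [folklore] -/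
def coneValue (a : ℝ) : ℝ := sInf (valueSet a)

/-! ## `rfl` bridges to the Weil vocabulary -/

open Literature.NumberTheory.LFunctions

/-- `autocorr g` IS `weilConv g (weilReflect g)`. [folklore] -/
theorem autocorr_eq_weilConv (g : ℝ → ℂ) : autocorr g = weilConv g (weilReflect g) := rfl

/-- `mellinShift` IS `weilMellin`. [folklore] -/
theorem mellinShift_eq_weilMellin (F : ℝ → ℂ) (s : ℂ) : mellinShift F s = weilMellin F s := rfl

/-- The integral of `archIntegrand F` IS `weilArchIntegral F`. [folklore] -/
theorem integral_archIntegrand_eq (F : ℝ → ℂ) : ∫ t : ℝ, archIntegrand F t = weilArchIntegral F := rfl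

/-- `reWar F` IS `Re (weilPolarTerm F + weilArchTerm F)`. [folklore] -/
theorem reWar_eq (F : ℝ → ℂ) : reWar F = (weilPolarTerm F + weilArchTerm F).re := rfl

/-- `IsConeFamily a k g` IS "every `gᵢ` is a Weil test function supported in `[-a, a]`". [folklore] -/
theorem isConeFamily_iff (a : ℝ) (k : ℕ) (g : Fin k → ℝ → ℂ) :
    IsConeFamily a k g ↔ ∀ i, IsWeilTest (g i) ∧ tsupport (g i) ⊆ Set.Icc (-a) a := Iff.rfl

/-- The `rfl` ANCHOR of this vocabulary file (registered stub `dualWitness_vocab` of stmt-RiemannHypothesis-16302, through which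
the file lands `--supports`): the line's objects ARE the Weil-API objects, and `coneValue` IS the infimum of `valueSet`. [folklore] -/
theorem dualWitness_vocab : (∀ g : ℝ → ℂ, autocorr g = weilConv g (weilReflect g)) ∧ (∀ (F : ℝ → ℂ) (s : ℂ), mellinShift F s = weilMellin F s) ∧ (∀ F : ℝ → ℂ, reWar F = (weilPolarTerm F + weilArchTerm F).re) ∧ ∀ a : ℝ, coneValue a = sInf (valueSet a) :=
  ⟨fun _ => rfl, fun _ _ => rfl, fun _ => rfl, fun _ => rfl⟩

end Summit.RiemannHypothesis.RiemannHypothesis.Theorems.SignCone.DualWitness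

end
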